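import Mathlib
import HarnessLib

/-!
# The gadget (2-sum) decomposition of the two-copy Harris form

Helper file for crux `stmt-CriticalPhenomena-4575` (new-inequality factory `prim-ineq-gen-1`, gen 16); memo
`run/shared/lean/prim/prim-ineq-gen-1/FINDING-22-series-parallel.md` §4 (LEMMA G).  Companion of `…TwoCopyTwistedProduct.lean`,
`…TwoCopySeriesParallel.lean` (THEOREM A) and the gen-15 files `…TwoCopyTwoSum*.lean`.

SETTING (abstract 2-sum `N = G₁ ⊕_{u,w} M`).  Side 1 (`G₁`, containing the event's vertices) is a finite configuration type `Ω₁`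
with TWO weight functions — `w0` (used when the gadget does NOT join the glue vertices `u,w`; for graphs `y^ω q^{k(ω)}`) and `wt`
(used when it does; for graphs `y^ω q^{k(ω)−1+[u~w]}`, the grading of `G₁/uw`) — and two Boolean events `U0 ≤ Up` (the event
read without / with a virtual edge `uw`; e.g. `[a~v]` in `G₁` resp. in `G₁ + uw`).  Side 2 (the gadget `M`) is a finite type `Ω₂`
with weights `w₂` and the Boolean `c₂ = [u ~ w in M]` (class `d` = `¬c₂`, class `c` = `c₂`).  The glued weight is
`w0 ω₁ · w₂ ω₂` on `d` and `wt ω₁ · w₂ ω₂` on `c`, the glued event is `U0 ω₁` on `d` and `Up ω₁` on `c` (`gW`, `gU`), and the glued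
two-copy Harris form against an arbitrary Boolean `V` on `Ω₁ × Ω₂` is `gH V = Z[U ∧ V]·Z[⊤] − Z[U]·Z[V]` (`gZ`, `gH`).

RESULT (`gadget_identity`, this work 2026-08-21): with `D = Σ_d w₂`, `C = Σ_c w₂`, the side-1 forms
`H1 w U V = Z_w[U∧V]·Z_w[⊤] − Z_w[U]·Z_w[V]` and the two 'mixed' forms
`S0 V₀ = Z_{w0}[U0∧V₀]·Z_{wt}[⊤] − Z_{wt}[Up]·Z_{w0}[V₀]`,  `S1 V₁ = Z_{wt}[Up∧V₁]·Z_{w0}[⊤] − Z_{w0}[U0]·Z_{wt}[V₁]`,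
   `gH V = D·Σ_{ω₂∈d} w₂ H1 w0 U0 V(·,ω₂) + C·Σ_{ω₂∈c} w₂ H1 wt Up V(·,ω₂) + C·Σ_{ω₂∈d} w₂ S0 V(·,ω₂) + D·Σ_{ω₂∈c} w₂ S1 V(·,ω₂)`
— the (dd), (cc) and (dc)+(cd) groups of the memo.  For the single-edge gadget (`Ω₂ = Bool`, `w₂ = (1, t)`, `c₂ = id`) this is the
expansion `H_{G₁+g}(U, (V₀ ⊆ V₁)) = H1 w0 U0 V₀ + t·(S0 V₀ + S1 V₁) + t²·H1 wt Up V₁` (`edge_expansion`).  Memo §4 combines the two: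
with a monotone (Strassen) coupling of the gadget's two conditional laws — available when `(M; u,w)` satisfies (H*), e.g. is
series–parallel (THEOREM A) — the glued form equals `D²·E_π[H_{G₁+g}(U, nested sections) at t = C/D]`, so real (H*) passes from
`G₁ + g` (effective weight, Wagner 2008) to the 2-sum: LEMMA G, whence the LADDER REDUCTION of the memo.  Only the ALGEBRA is
formalised here (any commutative ring); the coupling step is measure-theoretic and stays in the memo.
-/

namespace Summit.CriticalPhenomena.PercolationContinuityZ3.Theorems

namespace TwoCopyGadget

open Finset

variable {R : Type*} [CommRing R]
variable {Ω₁ Ω₂ : Type*} [Fintype Ω₁] [Fintype Ω₂]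

/-- Side-1 restricted sum `Z_w[P] = Σ_{ω : P ω} w ω`. [this work] -/
def zs (w : Ω₁ → R) (P : Ω₁ → Bool) : R := ∑ ω, if P ω then w ω else 0

/-- Side-1 two-copy Harris form `Z_w[U∧V]·Z_w[⊤] − Z_w[U]·Z_w[V]`. [this work] -/
def H1 (w : Ω₁ → R) (U V : Ω₁ → Bool) : R :=
  zs w (fun ω => U ω && V ω) * zs w (fun _ => true) - zs w U * zs w V

variable (w0 wt : Ω₁ → R) (U0 Up : Ω₁ → Bool) (w₂ : Ω₂ → R) (c₂ : Ω₂ → Bool)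

/-- Mixed form `S₀(V₀) = Z_{w0}[U0∧V₀]·Z_{wt}[⊤] − Z_{wt}[Up]·Z_{w0}[V₀]`. [this work] -/
def S0 (V0 : Ω₁ → Bool) : R :=
  zs w0 (fun ω => U0 ω && V0 ω) * zs wt (fun _ => true) - zs wt Up * zs w0 V0

/-- Mixed form `S₁(V₁) = Z_{wt}[Up∧V₁]·Z_{w0}[⊤] − Z_{w0}[U0]·Z_{wt}[V₁]`. [this work] -/
def S1 (V1 : Ω₁ → Bool) : R :=
  zs wt (fun ω => Up ω && V1 ω) * zs w0 (fun _ => true) - zs w0 U0 * zs wt V1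

/-- Glued weight: `w0·w₂` when the gadget does not join the glue pair, `wt·w₂` when it does. [this work] -/
def gW : Ω₁ × Ω₂ → R := fun ω => if c₂ ω.2 then wt ω.1 * w₂ ω.2 else w0 ω.1 * w₂ ω.2

/-- Glued event: `Up` when the gadget joins the glue pair, `U0` otherwise. [this work] -/
def gU : Ω₁ × Ω₂ → Bool := fun ω => if c₂ ω.2 then Up ω.1 else U0 ω.1

/-- Glued restricted sum `Z[P]`. [this work] -/
def gZ (P : Ω₁ × Ω₂ → Bool) : R := ∑ ω : Ω₁ × Ω₂, if P ω then gW w0 wt w₂ c₂ ω else 0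

/-- Glued two-copy Harris form `Z[U∧V]·Z[⊤] − Z[U]·Z[V]`. [this work] -/
def gH (V : Ω₁ × Ω₂ → Bool) : R :=
  gZ w0 wt w₂ c₂ (fun ω => gU U0 Up c₂ ω && V ω) * gZ w0 wt w₂ c₂ (fun _ => true)
    - gZ w0 wt w₂ c₂ (gU U0 Up c₂) * gZ w0 wt w₂ c₂ V

/-- Sum over the gadget's `d`-class (`u ≁ w`) with weights `w₂`. [this work] -/
def dsum (f : Ω₂ → R) : R := ∑ ω₂, if c₂ ω₂ then 0 else w₂ ω₂ * f ω₂

/-- Sum over the gadget's `c`-class (`u ~ w`) with weights `w₂`. [this work] -/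
def csum (f : Ω₂ → R) : R := ∑ ω₂, if c₂ ω₂ then w₂ ω₂ * f ω₂ else 0

/-- `dsum` is linear: `dsum (x·f − y·g) = x·dsum f − y·dsum g`. [this work] -/
theorem dsum_lin (x y : R) (f g : Ω₂ → R) :
    dsum w₂ c₂ (fun ω₂ => x * f ω₂ - y * g ω₂) = x * dsum w₂ c₂ f - y * dsum w₂ c₂ g := by
  unfold dsum
  rw [Finset.mul_sum, Finset.mul_sum, ← Finset.sum_sub_distrib]
  refine Finset.sum_congr rfl fun ω₂ _ => ?_
  split_ifs <;> ring

/-- `csum` is linear: `csum (x·f − y·g) = x·csum f − y·csum g`. [this work] -/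
theorem csum_lin (x y : R) (f g : Ω₂ → R) :
    csum w₂ c₂ (fun ω₂ => x * f ω₂ - y * g ω₂) = x * csum w₂ c₂ f - y * csum w₂ c₂ g := by
  unfold csum
  rw [Finset.mul_sum, Finset.mul_sum, ← Finset.sum_sub_distrib]
  refine Finset.sum_congr rfl fun ω₂ _ => ?_
  split_ifs <;> ring

/-- `dsum` of a constant: `dsum (λ_, x) = D·x`. [this work] -/
theorem dsum_const (x : R) : dsum w₂ c₂ (fun _ => x) = dsum w₂ c₂ (fun _ => 1) * x := by
  unfold dsum
  rw [Finset.sum_mul]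
  refine Finset.sum_congr rfl fun ω₂ _ => ?_
  split_ifs <;> ring

/-- `csum` of a constant: `csum (λ_, x) = C·x`. [this work] -/
theorem csum_const (x : R) : csum w₂ c₂ (fun _ => x) = csum w₂ c₂ (fun _ => 1) * x := by
  unfold csum
  rw [Finset.sum_mul]
  refine Finset.sum_congr rfl fun ω₂ _ => ?_
  split_ifs <;> ring

/-- SECTION FORMULA: every glued restricted sum splits over the gadget classes into section sums of side 1,
`Z[P] = Σ_{ω₂∈d} w₂·Z_{w0}[P(·,ω₂)] + Σ_{ω₂∈c} w₂·Z_{wt}[P(·,ω₂)]`. [this work] -/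
theorem gZ_split (P : Ω₁ × Ω₂ → Bool) :
    gZ w0 wt w₂ c₂ P
      = dsum w₂ c₂ (fun ω₂ => zs w0 fun ω₁ => P (ω₁, ω₂)) + csum w₂ c₂ (fun ω₂ => zs wt fun ω₁ => P (ω₁, ω₂)) := by
  unfold gZ dsum csum zs gW
  rw [Fintype.sum_prod_type_right, ← Finset.sum_add_distrib]
  refine Finset.sum_congr rfl fun ω₂ _ => ?_
  by_cases h : c₂ ω₂ = true
  · simp only [h, if_true, zero_add]
    rw [Finset.mul_sum]
    refine Finset.sum_congr rfl fun ω₁ _ => ?_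
    split_ifs <;> ring
  · simp only [Bool.not_eq_true] at h
    simp only [h, Bool.false_eq_true, if_false, add_zero]
    rw [Finset.mul_sum]
    refine Finset.sum_congr rfl fun ω₁ _ => ?_
    split_ifs <;> ring

omit [Fintype Ω₂] in
/-- Sections of the glued event: `U(·,ω₂) ∧ V(·,ω₂)` is `U0 ∧ V(·,ω₂)` on `d` and `Up ∧ V(·,ω₂)` on `c`. [this work] -/
theorem zs_gU_and (w : Ω₁ → R) (V : Ω₁ × Ω₂ → Bool) (ω₂ : Ω₂) :
    zs w (fun ω₁ => gU U0 Up c₂ (ω₁, ω₂) && V (ω₁, ω₂))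
      = if c₂ ω₂ then zs w (fun ω₁ => Up ω₁ && V (ω₁, ω₂)) else zs w (fun ω₁ => U0 ω₁ && V (ω₁, ω₂)) := by
  unfold zs gU
  by_cases h : c₂ ω₂ = true <;> simp [h]

omit [Fintype Ω₂] in
/-- Sections of the glued event alone. [this work] -/
theorem zs_gU (w : Ω₁ → R) (ω₂ : Ω₂) :
    zs w (fun ω₁ => gU U0 Up c₂ (ω₁, ω₂)) = if c₂ ω₂ then zs w Up else zs w U0 := by
  unfold zs gU
  by_cases h : c₂ ω₂ = true <;> simp [h]

/-- `dsum` only sees the `d`-branch of a class-dependent `if`. [this work] -/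
theorem dsum_ite (f g : Ω₂ → R) :
    dsum w₂ c₂ (fun ω₂ => if c₂ ω₂ then f ω₂ else g ω₂) = dsum w₂ c₂ g := by
  unfold dsum
  refine Finset.sum_congr rfl fun ω₂ _ => ?_
  by_cases h : c₂ ω₂ = true <;> simp [h]

/-- `csum` only sees the `c`-branch of a class-dependent `if`. [this work] -/
theorem csum_ite (f g : Ω₂ → R) :
    csum w₂ c₂ (fun ω₂ => if c₂ ω₂ then f ω₂ else g ω₂) = csum w₂ c₂ f := by
  unfold csum
  refine Finset.sum_congr rfl fun ω₂ _ => ?_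
  by_cases h : c₂ ω₂ = true <;> simp [h]

/-- THE GADGET IDENTITY (memo §4): the glued two-copy form is the sum of the (dd) group `D·Σ_d w₂·H1 w0 U0 V(·,ω₂)`, the (cc) group
`C·Σ_c w₂·H1 wt Up V(·,ω₂)` and the mixed group `C·Σ_d w₂·S0 V(·,ω₂) + D·Σ_c w₂·S1 V(·,ω₂)`. [this work] -/
theorem gadget_identity (V : Ω₁ × Ω₂ → Bool) :
    gH w0 wt U0 Up w₂ c₂ V
      = dsum w₂ c₂ (fun _ => 1) * dsum w₂ c₂ (fun ω₂ => H1 w0 U0 (fun ω₁ => V (ω₁, ω₂)))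
        + csum w₂ c₂ (fun _ => 1) * csum w₂ c₂ (fun ω₂ => H1 wt Up (fun ω₁ => V (ω₁, ω₂)))
        + csum w₂ c₂ (fun _ => 1) * dsum w₂ c₂ (fun ω₂ => S0 w0 wt U0 Up (fun ω₁ => V (ω₁, ω₂)))
        + dsum w₂ c₂ (fun _ => 1) * csum w₂ c₂ (fun ω₂ => S1 w0 wt U0 Up (fun ω₁ => V (ω₁, ω₂))) := by
  -- glued sums as class sums of sections
  have hUV : gZ w0 wt w₂ c₂ (fun ω => gU U0 Up c₂ ω && V ω)
      = dsum w₂ c₂ (fun ω₂ => zs w0 fun ω₁ => U0 ω₁ && V (ω₁, ω₂))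
        + csum w₂ c₂ (fun ω₂ => zs wt fun ω₁ => Up ω₁ && V (ω₁, ω₂)) := by
    rw [gZ_split]
    simp_rw [zs_gU_and]
    rw [dsum_ite, csum_ite]
  have hU : gZ w0 wt w₂ c₂ (gU U0 Up c₂)
      = dsum w₂ c₂ (fun _ => 1) * zs w0 U0 + csum w₂ c₂ (fun _ => 1) * zs wt Up := by
    rw [gZ_split]
    have h1 : (fun ω₂ => zs w0 fun ω₁ => gU U0 Up c₂ (ω₁, ω₂))
        = fun ω₂ => if c₂ ω₂ then zs w0 Up else zs w0 U0 := by
      funext ω₂; exact zs_gU U0 Up c₂ w0 ω₂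
    have h2 : (fun ω₂ => zs wt fun ω₁ => gU U0 Up c₂ (ω₁, ω₂))
        = fun ω₂ => if c₂ ω₂ then zs wt Up else zs wt U0 := by
      funext ω₂; exact zs_gU U0 Up c₂ wt ω₂
    rw [h1, h2, dsum_ite, csum_ite, dsum_const, csum_const]
  have h1 : gZ w0 wt w₂ c₂ (fun _ => true)
      = dsum w₂ c₂ (fun _ => 1) * zs w0 (fun _ => true) + csum w₂ c₂ (fun _ => 1) * zs wt (fun _ => true) := by
    rw [gZ_split, dsum_const, csum_const]
  have hV : gZ w0 wt w₂ c₂ V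
      = dsum w₂ c₂ (fun ω₂ => zs w0 fun ω₁ => V (ω₁, ω₂)) + csum w₂ c₂ (fun ω₂ => zs wt fun ω₁ => V (ω₁, ω₂)) :=
    gZ_split w0 wt w₂ c₂ V
  -- the right-hand side groups, by linearity of dsum / csum
  have r1 : dsum w₂ c₂ (fun ω₂ => H1 w0 U0 (fun ω₁ => V (ω₁, ω₂)))
      = zs w0 (fun _ => true) * dsum w₂ c₂ (fun ω₂ => zs w0 fun ω₁ => U0 ω₁ && V (ω₁, ω₂))
        - zs w0 U0 * dsum w₂ c₂ (fun ω₂ => zs w0 fun ω₁ => V (ω₁, ω₂)) := by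
    rw [← dsum_lin]; unfold H1; congr 1; funext ω₂; ring
  have r2 : csum w₂ c₂ (fun ω₂ => H1 wt Up (fun ω₁ => V (ω₁, ω₂)))
      = zs wt (fun _ => true) * csum w₂ c₂ (fun ω₂ => zs wt fun ω₁ => Up ω₁ && V (ω₁, ω₂))
        - zs wt Up * csum w₂ c₂ (fun ω₂ => zs wt fun ω₁ => V (ω₁, ω₂)) := by
    rw [← csum_lin]; unfold H1; congr 1; funext ω₂; ring
  have r3 : dsum w₂ c₂ (fun ω₂ => S0 w0 wt U0 Up (fun ω₁ => V (ω₁, ω₂)))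
      = zs wt (fun _ => true) * dsum w₂ c₂ (fun ω₂ => zs w0 fun ω₁ => U0 ω₁ && V (ω₁, ω₂))
        - zs wt Up * dsum w₂ c₂ (fun ω₂ => zs w0 fun ω₁ => V (ω₁, ω₂)) := by
    rw [← dsum_lin]; unfold S0; congr 1; funext ω₂; ring
  have r4 : csum w₂ c₂ (fun ω₂ => S1 w0 wt U0 Up (fun ω₁ => V (ω₁, ω₂)))
      = zs w0 (fun _ => true) * csum w₂ c₂ (fun ω₂ => zs wt fun ω₁ => Up ω₁ && V (ω₁, ω₂))
        - zs w0 U0 * csum w₂ c₂ (fun ω₂ => zs wt fun ω₁ => V (ω₁, ω₂)) := by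
    rw [← csum_lin]; unfold S1; congr 1; funext ω₂; ring
  unfold gH
  rw [hUV, hU, h1, hV, r1, r2, r3, r4]
  ring

/-- THE SINGLE-EDGE EXPANSION: for the gadget 'one edge `uw` of weight `t`' (`Ω₂ = Bool`, `w₂ false = 1`, `w₂ true = t`, `c₂ = id`)
and a nested pair of up-sets read as `V (ω₁, false) = V₀ ω₁`, `V (ω₁, true) = V₁ ω₁`:
`H_{G₁+g}(U, V) = H1 w0 U0 V₀ + t·(S0 V₀ + S1 V₁) + t²·H1 wt Up V₁`. [this work] -/
theorem edge_expansion (t : R) (V : Ω₁ × Bool → Bool) :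
    gH w0 wt U0 Up (fun b : Bool => if b then t else 1) (fun b => b) V
      = H1 w0 U0 (fun ω₁ => V (ω₁, false))
        + t * (S0 w0 wt U0 Up (fun ω₁ => V (ω₁, false)) + S1 w0 wt U0 Up (fun ω₁ => V (ω₁, true)))
        + t ^ 2 * H1 wt Up (fun ω₁ => V (ω₁, true)) := by
  rw [gadget_identity]
  unfold dsum csum
  simp only [Fintype.sum_bool, Bool.false_eq_true, if_true, if_false]
  ring

end TwoCopyGadget

end Summit.CriticalPhenomena.PercolationContinuityZ3.Theorems
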